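import Literature.NumberTheory.Deninger2022.ArithmeticCohomology
import Literature.NumberTheory.LFunctions.WeilCriterionProofs
import Literature.NumberTheory.LFunctions.SimpleZeros

/-!
# Constraints on Deninger's would-be polarized carrier `(H¹, θ, ⟨,⟩)` (motivic door, cc-4 gen 2: the located gap as kernel objects)

`Literature.NumberTheory.Deninger2022` types Deninger's axioms (2.3) (`SpectrumAxiom θ`: the
generalized eigenspaces of `θ` on `H¹` have dimensions the orders of the zeros of `ζ`), (2.5)+(2.7)
(`CupLeibniz`, `HodgeStar`) and their consequence (2.7′)+positivity (`Polarized θ B`: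
`B(θh,h') + B(h,θh') = B(h,h')`, `B` positive definite) — C. Deninger, arXiv:2204.02714 §2 — and
proves Serre's argument `SpectrumAxiom θ → Polarized θ B → RiemannHypothesis` and
`ker (θ-ρ)² = ker (θ-ρ)`.  The cell's located-gap entry (HOME/LOCATED-GAP.md §cc-4, ruling G11)
names the MISSING OBJECT of the programme as the polarization `(∗, ⟨,⟩)` on a carrier with (2.3).

This file records, sorry-free, the STRUCTURAL CONSTRAINTS that any future construction of that
object must satisfy — so that a paper claiming to construct `(H¹, θ, ∗)` can be checked against
them — and the dictionary "needed inequality = Weil positivity" as a single equivalence: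

* (S) semisimplicity in full: `ker (θ-ρ)^(k+1) = ker (θ-ρ)` and `H^{θ∼ρ} = H^{θ=ρ}`
  (`maxGenEigenspace_eq_eigenspace_of_polarized`), hence under (2.3) every EIGENSPACE has
  dimension exactly `m(ρ)` (`finrank_eigenspace_of_spectrumAxiom_of_polarized`).  Deninger states
  this in words (arXiv:2204.02714 p.3: "skew-symmetry of `θ - ½` would imply that the algebraic
  eigenspaces `H^{θ∼α}` of `θ` are the usual ones `H^{θ=α}`").
* (N2) the obstruction this puts on EXISTING carriers: a carrier with (2.3) whose eigenspace at
  some zero is smaller than `m(ρ)` admits no polarization (`not_polarized_of_finrank_eigenspace_lt`);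
  a carrier with (2.3) all of whose eigenspaces at zeros have dimension `≤ 1` — the shape of
  R. Meyer's spectral realization `π₋` (Duke Math. J. 127 (2005) = arXiv:math/0412277, proof of
  Cor. 4.2: an eigenvector of `ᵗD₋` for `s` is a multiple of `h ↦ ĥ(s)`), where the algebraic
  multiplicity is `ord_s ζ` (`Literature.NumberTheory.Automorphic.Meyer.spectralRealisation_rat`,
  PROVED in the tree) — can be polarized only if ALL ZEROS OF `ζ` ARE SIMPLE
  (`simpleZerosConjecture_of_polarized_of_finrank_eigenspace_le_one`; the open
  `Literature.NumberTheory.LFunctions.SimpleZerosConjecture`).  The Meyer-side premise (geometric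
  multiplicity one) is NOT formalised here; it enters only as the hypothesis `hdim`.
* (O) orthogonality: eigenvectors of a polarized `θ` for distinct eigenvalues are `⟨,⟩`-orthogonal
  (`form_eq_zero_of_eigen_of_ne`), and the Hodge `∗` of (2.7) maps `H^{θ=ρ}` to `H^{θ=1-ρ}`
  (`hodgeStar_mem_eigenspace_one_sub`) — the compatibility of `∗` with the duality (2.6).
* (D3) the trace dictionary on finite packets of eigenvalues: for a Weil test function `g`,
  `Σ_{ρ∈F} m(ρ) (g ⋆ g̃)^(ρ) = Σ_{ρ∈F} m(ρ) |ĝ(ρ)|² ≥ 0` whenever the `ρ ∈ F` are eigenvalues of a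
  polarized `θ` (`packetTrace_eq_sum_normSq`, `packetTrace_re_nonneg`): the finite-rank shadow of
  "`Tr(A_g A_g†) ≥ 0`, `A_g = ∫ g(t) e^{t(θ-½)} dt`" (Deninger, Jber. DMV 103 (2001) =
  arXiv:math/0204110 §3; Bombieri 2000 §3 eq. (3.2) for the transform identity, here the tree's
  `weilMellin_weilQuadratic_of_re_eq`).
* (W) the needed inequality IS Weil positivity: `ZerosAreEigenvalues θ → Polarized θ B →
  WeilPositivity` (`weilPositivity_of_zerosAreEigenvalues_of_polarized`).  The equivalence
  `(∃ θ B, ZerosAreEigenvalues θ ∧ Polarized θ B) ↔ WeilPositivity` ("one located gap, two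
  carriers") is the one-line composition
  `DeningerSpectrumModel.riemannHypothesis_iff_exists_polarized.symm.trans weil_criterion_holds` of
  two landed theorems (`Theorems/MotivicDoorDeningerSpectrumModel.lean`, `WeilCriterionProofs.lean`);
  it is not restated here only to keep this file's imports inside `Literature`.

Honest grade: elementary consequences of the typed axioms (linear algebra + bookkeeping); (W) and
the `SimpleZerosConjecture` corollary route through `RiemannHypothesis` (Serre's argument) and claim
nothing new about `ζ`.  Nothing here constructs a carrier.  Labels: every `theorem` PROVED;
the Meyer premise and Deninger's axioms are HYPOTHESES.
References: C. Deninger, arXiv:2204.02714 §2 (2.3)–(2.7); C. Deninger, arXiv:math/0204110 §§2–3;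
R. Meyer, arXiv:math/0412277 Cor. 4.2; E. Bombieri, Rend. Lincei (9) 11 (2000) §3; J.-P. Serre,
Ann. of Math. 71 (1960) 392–394.
-/

set_option linter.dupNamespace false

noncomputable section

open Complex Module Module.End
open Literature.NumberTheory.LFunctions Literature.NumberTheory.Deninger2022

namespace Summit.RiemannHypothesis.RiemannHypothesis.Theorems.MotivicDoor.DeningerConstraints

variable {H : Type*} [AddCommGroup H] [Module ℂ H]
variable {θ : End ℂ H} {B : H →ₗ[ℂ] H →ₗ⋆[ℂ] ℂ}

/-! ## (S) Semisimplicity of a polarized `θ` -/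

/-- All higher kernels of `θ - ρ` collapse: `ker (θ-ρ)^(k+1) = ker (θ-ρ)` for a polarized `θ`
(from `ker (θ-ρ)² = ker (θ-ρ)`, `Literature.NumberTheory.Deninger2022.ker_sq_eq_ker_of_polarized`,
and `Module.End.ker_pow_constant`). [cite: Deninger2022, §2 after (2.7), arXiv p.3] -/
theorem ker_pow_succ_eq_ker_of_polarized (hP : Polarized θ B) (ρ : ℂ) (k : ℕ) :
    LinearMap.ker ((θ - ρ • 1) ^ (k + 1)) = LinearMap.ker (θ - ρ • 1) := by
  have h1 : LinearMap.ker ((θ - ρ • 1) ^ 1) = LinearMap.ker ((θ - ρ • 1) ^ 2) := by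
    rw [pow_one, sq]
    exact (ker_sq_eq_ker_of_polarized hP ρ).symm
  have h2 := Module.End.ker_pow_constant (k := 1) h1 k
  rw [pow_one, add_comm] at h2
  exact h2.symm

/-- **`H^{θ∼ρ} = H^{θ=ρ}`**: the generalized eigenspaces of a polarized `θ` are its eigenspaces
(Deninger: "skew-symmetry of `θ - ½` would imply that the algebraic eigenspaces `H^{θ∼α}` of `θ`
are the usual ones `H^{θ=α}`"). [cite: Deninger2022, §2 after (2.7), arXiv p.3] -/
theorem maxGenEigenspace_eq_eigenspace_of_polarized (hP : Polarized θ B) (ρ : ℂ) :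
    θ.maxGenEigenspace ρ = θ.eigenspace ρ := by
  refine le_antisymm (fun h hh => ?_) eigenspace_le_maxGenEigenspace
  obtain ⟨k, hk⟩ := (mem_maxGenEigenspace θ ρ h).mp hh
  rw [eigenspace_def, LinearMap.mem_ker]
  cases k with
  | zero =>
    simp at hk
    simp [hk]
  | succ k =>
    have hmem : h ∈ LinearMap.ker ((θ - ρ • 1) ^ (k + 1)) := hk
    rwa [ker_pow_succ_eq_ker_of_polarized hP ρ k, LinearMap.mem_ker] at hmem

/-- Under the spectrum axiom (2.3) a polarization forces every EIGENSPACE `H^{θ=ρ}` to be finite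
dimensional of dimension exactly `m(ρ)` (the order of `ζ` at `ρ`; `0` off the non-trivial zeros).
A checkable constraint on any constructed `(H¹, θ, ∗)`. [cite: Deninger2022, §2 (2.3) and after (2.7), arXiv p.3] -/
theorem finrank_eigenspace_of_spectrumAxiom_of_polarized (h23 : SpectrumAxiom θ)
    (hP : Polarized θ B) (ρ : ℂ) :
    FiniteDimensional ℂ (θ.eigenspace ρ) ∧
      Module.finrank ℂ (θ.eigenspace ρ) = zetaMultiplicity ρ := by
  rw [← maxGenEigenspace_eq_eigenspace_of_polarized hP ρ]
  exact h23 ρ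

/-! ## (N2) The obstruction on existing carriers -/

/-- A carrier `(H¹, θ)` satisfying (2.3) whose eigenspace at some `ρ` is smaller than `m(ρ)`
(a non-trivial Jordan block at a multiple zero) admits NO polarization. [cite: Deninger2022, §2 after (2.7), arXiv p.3] -/
theorem not_polarized_of_finrank_eigenspace_lt (h23 : SpectrumAxiom θ) {ρ : ℂ}
    (hlt : Module.finrank ℂ (θ.eigenspace ρ) < zetaMultiplicity ρ)
    (B : H →ₗ[ℂ] H →ₗ⋆[ℂ] ℂ) : ¬ Polarized θ B := fun hP =>
  absurd (finrank_eigenspace_of_spectrumAxiom_of_polarized h23 hP ρ).2 (ne_of_lt hlt)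

/-- On a carrier with (2.3) all of whose eigenspaces at non-trivial zeros have dimension `≤ 1`
(the shape of Meyer's `π₋`, arXiv:math/0412277 proof of Cor. 4.2 — a HYPOTHESIS here), a
polarization forces `m(ρ) ≤ 1` at every `ρ`. [cite: Meyer2005, Cor. 4.2 (proof)] -/
theorem zetaMultiplicity_le_one_of_polarized (h23 : SpectrumAxiom θ) (hP : Polarized θ B)
    (hdim : ∀ ρ ∈ ZetaZeros.riemannZetaNontrivialZeros, Module.finrank ℂ (θ.eigenspace ρ) ≤ 1)
    (ρ : ℂ) : zetaMultiplicity ρ ≤ 1 := by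
  by_cases hρ : ρ ∈ ZetaZeros.riemannZetaNontrivialZeros
  · rw [← (finrank_eigenspace_of_spectrumAxiom_of_polarized h23 hP ρ).2]
    exact hdim ρ hρ
  · simp [zetaMultiplicity, hρ]

/-- **A polarization on a Meyer-shaped carrier forces all zeros of `ζ` to be simple**: (2.3) ∧
(2.7′) ∧ positivity ∧ (eigenspaces at zeros of dimension `≤ 1`) ⇒
`Literature.NumberTheory.LFunctions.SimpleZerosConjecture` (open).  So Deninger's (2.7) cannot be
realised on such a carrier unless the simple-zeros conjecture holds — the typed form of located-gap
item N2. [cite: Meyer2005, Cor. 4.2 (proof); Deninger2022 §2 (2.7)] -/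
theorem simpleZerosConjecture_of_polarized_of_finrank_eigenspace_le_one (h23 : SpectrumAxiom θ)
    (hP : Polarized θ B)
    (hdim : ∀ ρ ∈ ZetaZeros.riemannZetaNontrivialZeros, Module.finrank ℂ (θ.eigenspace ρ) ≤ 1) :
    SimpleZerosConjecture := by
  rw [simpleZerosConjecture_iff_order_eq_one]
  intro ρ hρ
  have hρ' : ρ ∈ ZetaZeros.riemannZetaNontrivialZeros := hρ
  have hm : zetaMultiplicity ρ ≤ 1 := zetaMultiplicity_le_one_of_polarized h23 hP hdim ρ
  have h1 : ρ ≠ 1 := ne_one_of_mem_riemannZetaNontrivialZeros hρ'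
  have hpos : 0 < riemannZetaZeroOrder ρ := (riemannZetaZeroOrder_pos_iff h1).mpr hρ'.1
  have hdef : zetaMultiplicity ρ = (riemannZetaZeroOrder ρ).toNat := by
    simp [zetaMultiplicity, hρ']
  have hcast : (((riemannZetaZeroOrder ρ).toNat : ℕ) : ℤ) = riemannZetaZeroOrder ρ :=
    Int.toNat_of_nonneg hpos.le
  rw [hdef] at hm
  omega

/-! ## (O) Orthogonality and the Hodge `∗` -/

/-- Eigenvectors of a polarized `θ` with distinct eigenvalues are `⟨,⟩`-orthogonal:
`(ρ + ρ̄' - 1)⟨h,h'⟩ = 0` by (2.7′), and `ρ̄' = 1 - ρ'` since `Re ρ' = ½`. [cite: Deninger2022, §2 after (2.7), arXiv p.3] -/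
theorem form_eq_zero_of_eigen_of_ne (hP : Polarized θ B) {ρ ρ' : ℂ} {h h' : H}
    (hh : θ h = ρ • h) (hh' : θ h' = ρ' • h') (hne : ρ ≠ ρ') : B h h' = 0 := by
  by_cases h0 : h = 0
  · simp [h0]
  by_cases h0' : h' = 0
  · simp [h0']
  have hre' : ρ'.re = 1 / 2 :=
    re_eq_half_of_hasEigenvector hP ⟨mem_eigenspace_iff.mpr hh', h0'⟩
  have key := hP.1 h h'
  rw [hh, hh', LinearMap.map_smul, LinearMap.map_smulₛₗ, LinearMap.smul_apply, smul_eq_mul,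
    smul_eq_mul] at key
  have hconj : starRingEnd ℂ ρ' = 1 - ρ' := by
    apply Complex.ext
    · rw [Complex.conj_re, Complex.sub_re, Complex.one_re, hre']; norm_num
    · rw [Complex.conj_im, Complex.sub_im, Complex.one_im]; ring
  rw [hconj] at key
  have hmul : (ρ - ρ') * B h h' = 0 := by linear_combination key
  exact (mul_eq_zero.mp hmul).resolve_left (sub_ne_zero.mpr hne)

/-- The anti-linear `∗` of (2.7) commutes with `θ`, hence sends a `ρ`-eigenvector to a
`ρ̄`-eigenvector. [cite: Deninger2022, §2 (2.7), arXiv p.3] -/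
theorem hodgeStar_apply_eigenvector {C : H →ₗ[ℂ] H →ₗ[ℂ] ℂ} {star : H →ₗ⋆[ℂ] H}
    (hS : HodgeStar θ C star B) {ρ : ℂ} {h : H} (hh : θ h = ρ • h) :
    θ (star h) = starRingEnd ℂ ρ • star h := by
  rw [← hS.2.1 h, hh, LinearMap.map_smulₛₗ]

/-- **`∗ : H^{θ=ρ} → H^{θ=1-ρ}`**: given (2.5) and (2.7), `∗` maps the `ρ`-eigenspace into the
`(1-ρ)`-eigenspace (`ρ̄ = 1 - ρ` because the induced form is a polarization, so `Re ρ = ½`) —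
the compatibility of the Hodge `∗` with the duality (2.6) `H^{θ∼ρ} × H^{θ∼1-ρ} → ℂ`.
[cite: Deninger2022, §2 (2.6) (2.7), arXiv p.3] -/
theorem hodgeStar_mem_eigenspace_one_sub {C : H →ₗ[ℂ] H →ₗ[ℂ] ℂ} {star : H →ₗ⋆[ℂ] H}
    (hL : CupLeibniz θ C) (hS : HodgeStar θ C star B) {ρ : ℂ} {h : H}
    (hh : h ∈ θ.eigenspace ρ) : star h ∈ θ.eigenspace (1 - ρ) := by
  by_cases h0 : h = 0
  · simp [h0]
  have hre : ρ.re = 1 / 2 := re_eq_half_of_hasEigenvector (polarized_of_hodgeStar hL hS) ⟨hh, h0⟩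
  rw [mem_eigenspace_iff] at hh ⊢
  rw [hodgeStar_apply_eigenvector hS hh]
  congr 1
  apply Complex.ext
  · rw [Complex.conj_re, Complex.sub_re, Complex.one_re, hre]; norm_num
  · rw [Complex.conj_im, Complex.sub_im, Complex.one_im]; ring

/-! ## (D3) The trace dictionary on finite packets: `Σ m(ρ) (g ⋆ g̃)^(ρ) = Σ m(ρ) |ĝ(ρ)|² ≥ 0` -/

/-- For a Weil test function `g` and a finite set `F` of EIGENVALUES of a polarized `θ`,
`Σ_{ρ∈F} m(ρ) (g ⋆ g̃)^(ρ) = Σ_{ρ∈F} m(ρ) |ĝ(ρ)|²` (each `ρ ∈ F` has `Re ρ = ½`, and on the line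
`(g ⋆ g̃)^(ρ) = |ĝ(ρ)|²`, `weilMellin_weilQuadratic_of_re_eq`; Bombieri 2000 §3 (3.2)). This is
the finite-rank shadow of `Tr(A_{g⋆g̃}) = Tr(A_g A_g†)` for `A_g = ∫ g(t) e^{t(θ-½)} dt`.
[cite: Bombieri2000, §3 eq. (3.2); Deninger2002 §3] -/
theorem packetTrace_eq_sum_normSq (hP : Polarized θ B) {g : ℝ → ℂ} (hg : IsWeilTest g)
    (F : Finset ℂ) (hF : ∀ ρ ∈ F, θ.HasEigenvalue ρ) :
    ∑ ρ ∈ F, (zetaMultiplicity ρ : ℂ) * weilMellin (weilConv g (weilReflect g)) ρ =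
      ((∑ ρ ∈ F, (zetaMultiplicity ρ : ℝ) * Complex.normSq (weilMellin g ρ) : ℝ) : ℂ) := by
  push_cast
  refine Finset.sum_congr rfl fun ρ hρ => ?_
  rw [weilMellin_weilQuadratic_of_re_eq hg (re_eq_half_of_hasEigenvalue hP (hF ρ hρ))]

/-- Positivity of the packet traces: `0 ≤ Re Σ_{ρ∈F} m(ρ) (g ⋆ g̃)^(ρ)` for eigenvalue packets of a
polarized `θ`. [cite: Bombieri2000, §3 eq. (3.2); Deninger2002 §3] -/
theorem packetTrace_re_nonneg (hP : Polarized θ B) {g : ℝ → ℂ} (hg : IsWeilTest g)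
    (F : Finset ℂ) (hF : ∀ ρ ∈ F, θ.HasEigenvalue ρ) :
    0 ≤ (∑ ρ ∈ F, (zetaMultiplicity ρ : ℂ) * weilMellin (weilConv g (weilReflect g)) ρ).re := by
  rw [packetTrace_eq_sum_normSq hP hg F hF, Complex.ofReal_re]
  exact Finset.sum_nonneg fun ρ _ => mul_nonneg (Nat.cast_nonneg _) (Complex.normSq_nonneg _)

/-- The same for packets of non-trivial zeros on a carrier where zeros are eigenvalues (half of
(2.3)). [cite: Deninger2022, §2 (2.3), arXiv p.3] -/
theorem packetTrace_re_nonneg_of_zeros (h23 : ZerosAreEigenvalues θ) (hP : Polarized θ B)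
    {g : ℝ → ℂ} (hg : IsWeilTest g) (F : Finset ℂ)
    (hF : ∀ ρ ∈ F, ρ ∈ ZetaZeros.riemannZetaNontrivialZeros) :
    0 ≤ (∑ ρ ∈ F, (zetaMultiplicity ρ : ℂ) * weilMellin (weilConv g (weilReflect g)) ρ).re :=
  packetTrace_re_nonneg hP hg F fun ρ hρ => h23 ρ (hF ρ hρ)

/-- The tree's truncated zero sides `Σ_{|Im ρ| ≤ T} m(ρ) (g ⋆ g̃)^(ρ)` of the explicit formula have
non-negative real part on any carrier with zeros-as-eigenvalues and a polarization (through
`RiemannHypothesis`; `weilZeroSidePartial_weilQuadratic_re_nonneg`). [cite: Bombieri2000, §3 eq. (3.2)] -/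
theorem weilZeroSidePartial_re_nonneg_of_polarized (h23 : ZerosAreEigenvalues θ)
    (hP : Polarized θ B) {g : ℝ → ℂ} (hg : IsWeilTest g) (T : ℝ) :
    0 ≤ (weilZeroSidePartial (weilConv g (weilReflect g)) T).re :=
  weilZeroSidePartial_weilQuadratic_re_nonneg
    (riemannHypothesis_of_zerosAreEigenvalues_of_polarized h23 hP) hg T

/-! ## (W) The needed inequality is Weil positivity -/

/-- A carrier on which the non-trivial zeros are eigenvalues and which carries a polarization
yields Weil positivity `Re W(g ⋆ g̃) ≥ 0` (through RH and the easy half of Weil's criterion,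
`WeilPositivity.of_riemannHypothesis`, with the tree's proved `explicit_formula_holds`).
[cite: Bombieri2000, §3 Thm 1 eq. (3.2); Deninger2022 §2] -/
theorem weilPositivity_of_zerosAreEigenvalues_of_polarized (h23 : ZerosAreEigenvalues θ)
    (hP : Polarized θ B) : WeilPositivity :=
  WeilPositivity.of_riemannHypothesis explicit_formula_holds
    (riemannHypothesis_of_zerosAreEigenvalues_of_polarized h23 hP)

end Summit.RiemannHypothesis.RiemannHypothesis.Theorems.MotivicDoor.DeningerConstraints

end
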